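import Literature.MathematicalPhysics.QuantumFieldTheory.Balaban1983to89.B8Eq142KLevelLocal
import Literature.MathematicalPhysics.QuantumFieldTheory.Balaban1983to89.B8Eq178Averages
import HarnessLib

/-!
# Line H (`BirthV10.stub_halvingStep`, stmt-QuantumFields-19200), THIN ROAD γ, (M2′) «MIXED-END TOP (1.42)» — THE `ℤᵈ` SPINE:
# ★★ (1.42) AT A CROSSING TOP BOND WHOSE CONSTRAINED END CARRIES AN APPROXIMATE (1.29)∕(87) (a DEFECT `θ`), flat background

Cell `ym3-torus` (HUMAN RULING D-0037: YM₃ on T³ is ladder rung R3 — NOT d = 4, NOT a mass gap, NOT the Clay problem), width seat `ym-ust-20520-w5` gen 9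
(LOCATE-2 «(M2) joint» 61dadb20 §1, ★w3-19200 g9 LOCATE ccd3bf7e (M2′)).  `--supports stmt-QuantumFields-19200 --as helper`; THEOREMS ONLY (0 `def`,
0 `sorry`); count-neutral; nothing here claims the composers' residual `H42topCrossT`, the stub, the crux or the gap.

THE POINT.  Thin road γ's (1.42) clause at the TOP level `k = K − n` must hold on print's class `cubeLamBP′ … k k k`, which contains, besides the inner bonds of
`□^{(k)}` (handled by the ε₁-route ✓`HalvingHSiteTopH42Datum.htop_of_knitGauge` ∕ ✓`P1FlatCoreTopH42Gamma`), the CROSSING bonds with one end-block in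
`□^{(k)}` and the other in the collar `□_{k−1} ∖ □_k`.  Print ([Balaban1985RegularSpaces] p.82, (1.29)–(1.31)) reaches them through (1.29) at level `k` at the
inner end AND (1.29) at level `k − 1` on the collar block; lit's engine ✓`B8Eq142KLevelLocal.norm_Qj_lt_crossing_loc` accordingly needs (87) of
[Balaban1985Averaging] at BOTH ends (`h87`, `hp`).  Our chain keeps (1.29) only BELOW the top for the composite gauge (✓`HalvingP1FlatCoreSupplierRestr129.
restr129_product_of_topRows`: `Restr129 … (Function.update Λs k ∅) …`), replacing it at the top by the knit's axial normalisation — so at the inner end (87)@k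
holds only APPROXIMATELY.  THIS FILE is the per-bond engine for that situation, in lit's `ℤᵈ` letters at the FLAT background `U₀ = 1`:
* §1 ★ `dbavgCovIter_one_eq_uavg_conj` — the EXACT FACTORISATION of the top double-bar variable of `V′` through the tilde average of the axial datum
  `U♯ := mgauge 1 u V′` and the `k`-fold averages `(R̄₀u)^{(k)}` of the gauge at the two end-blocks:
  `U̿^{(k)}(V′)(c) = ((R̄₀u)^{(k)}(c₋))⁻¹ · Ũ♯^{(k)}(c) · (R̄₀u)^{(k)}(c₊)` — [3] (92) ∘ (71) ∘ (84), the latter at BOTH ends (available because J3's pre-gauge is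
  axial in the FULL tower under every site, `InAx … Λ …` for every `Λ`); this is simpler than print's crossing formula (1.31) (which has (84) only under `Λ_j`).
* §2 ★ `uavg_succ_eq_one_of_restr129_update` — at the COLLAR end the factor is `1` on the nose: (1.29) at level `k − 1` on the `L`-block (kept by the emptied-top
  `Restr129`) ∘ ✓`B8Eq178Averages.rbar_succ_eq_one_of_block`; and `hax_of_inAx` — the tower axiality in ✓`B8Eq131Derivation.eq84_local`'s letters from `InAx`.
* §3 ★★ `norm_logCovIter_succ_le_of_defect` — GLOBAL regime: with the (127) identification below the top, `‖Ũ♯^{(k)}(c) − 1‖ ≤ s` ((1.35)@k = J3 (d) at depth 0),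
  one end factor `= 1` and the other within `θ` of `1` (either orientation), `s + 2θ(1+s) ≤ ½`: `‖Q_k(1, B)(c)‖ ≤ 2·(s + 2θ(1+s))`.
* §4 ★★★ `norm_logCovIter_succ_lt_crossing_of_defect_loc` — the TOWER-LOCAL form (exponent clamped to the bond's box exactly as lit's `norm_Qj_lt_crossing_loc`;
  flat background, so (1.40) is free), [3] Prop. 4's window at `L^{j+1}·b`, conclusion `< 2dLα₁` under the displayed scalar row `2(s + 2θ(1+s)) < 2dLα₁`.
The θ-supplier (the knit gauge's `‖(R̄₀u₀)^{(k)}(y_in) − 1‖ ≤ θ`, `θ ≈ (1+s)^{d(M′−1)} − 1`: LOCATE-2 §3) and the composers' datum-closed socket are NOT in this file.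
HONEST SCOPE: lit-letter algebra + one norm estimate; nothing of Prop. 3∕5, Theorem 4, the stub or the crux is proved here.

References: T. Bałaban, CMP **99** (1985) 75–102 [Balaban1985RegularSpaces] ((1.29)–(1.31) pp.81–82, (1.35) p.82, (1.37) p.82, (1.42) p.83); CMP **98** (1985) 17–51
[Balaban1985Averaging] ((55) p.27, (69)–(71) p.29, (78)–(80) p.30, (84)–(87) pp.30–31, (92) p.31, (127) p.37, Prop. 4 pp.38–39).
-/

set_option autoImplicit false

noncomputable section

open NormedSpace

namespace Summit.QuantumFields.YangMills.Theorems.HalvingTopCrossingQkOfDefect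

open Literature.MathematicalPhysics.QuantumFieldTheory.Balaban1983to89
open MatrixLog (mlog norm_mlog_le_two_mul)
open B7Prop1Explicit (Site e U1 treeWord boxVec)
open B7Prop2Explicit (avgIter unitaryUnits AvgClosed C0 c2' avgClosed_unitaryUnits)
open B7Prop1Local (InBox AgreeOn loK bondHiK avgIter_congr clamp clamp_of_inBox clamp_inBox)
open B7Prop3Flat (expCfg c3)
open B7Prop5Flat (BondIn)
open B7Prop4GeneralLevels (logCovIter)
open B7LocalityGeneral (logCovIter_congr)
open B7Eq92Concrete (mgauge mgauge_apply tildIter tildIter_apply tildIter_mgauge dbavgCovIter Rc Rc_apply tHol)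
open B7Eq99Concrete (wrec eq92)
open B7Eq84Concrete (uavg)
open B7AvgGaugeCovariance (uLev)
open B7Eq123General (dbavgCovIter_eq_expCfg_logCovIter)
open B8Ineq130 (tlo thi)
open B8Ineq132 (Under)
open B8Eq119TwistedAxial (Restr129 InAx)
open B8Eq131Derivation (eq84_local ax119_iff_ax67)
open B8Eq137QjEqB (logCovIter_succ_eq_mlog)
open B8Ineq172Concrete (wrec_congr_tower)
open B8Eq142KLevelLocal (inBox_box_of_tower_fst inBox_box_of_tower_snd)
open B8Eq178Averages (restr129_iff_uavg rbar_succ_eq_one_of_block rbar_bgT_eq_uavg)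
open B8Thm2LogB (blockTop)
open Literature.MathematicalPhysics.QuantumLattice (blockSites blockBase)

variable {d : ℕ}

/-! ## §1 The exact factorisation of the top double-bar variable at the flat background -/

section Factorisation

variable {𝔸 : Type*} [NormedRing 𝔸] [NormedAlgebra ℂ 𝔸] [CompleteSpace 𝔸]

/-- ★ **EXACT FACTORISATION** ([3] (92) ∘ (71) ∘ (84) at the flat background): for a gauge `u`, a field `V′` and the datum `U♯ := mgauge 1 u V′`, if the tilde
averages of `U♯` are axial in the towers under the two end-blocks `z`, `z + e_κ` of a level-`k` bond (`hax₁`, `hax₂`, ✓`eq84_local`'s letters), then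
`U̿^{(k)}(V′)(z, κ) = ((R̄₀u)^{(k)}(z))⁻¹ · Ũ♯^{(k)}(z, κ) · (R̄₀u)^{(k)}(z + e_κ)` with `(R̄₀u)^{(k)} = uavg L 1 u k`.
[cite: Balaban1985Averaging, (92) p.31, (71) p.29, (84) p.30; Balaban1985RegularSpaces, (1.30)-(1.31) pp.81-82] -/
theorem dbavgCovIter_one_eq_uavg_conj (L : ℕ) (hL : 1 ≤ L) (u : Site d → 𝔸ˣ) (V' : Site d → Fin d → 𝔸ˣ) (k : ℕ)
    (z : Site d) (κ : Fin d)
    (hax₁ : ∀ n, n < k → ∀ w : Site d, Under L (k - (n + 1)) z w → ∀ r : Fin d → Fin L,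
      tHol (avgIter L (1 : Site d → Fin d → 𝔸ˣ) n) (tildIter L 1 (mgauge 1 u V') n) ((L : ℤ) • w) (treeWord (boxVec L r)) = 1)
    (hax₂ : ∀ n, n < k → ∀ w : Site d, Under L (k - (n + 1)) (z + e κ) w → ∀ r : Fin d → Fin L,
      tHol (avgIter L (1 : Site d → Fin d → 𝔸ˣ) n) (tildIter L 1 (mgauge 1 u V') n) ((L : ℤ) • w) (treeWord (boxVec L r)) = 1) :
    dbavgCovIter L 1 V' k z κ
      = (uavg L 1 u k z)⁻¹ * tildIter L 1 (mgauge 1 u V') k z κ * uavg L 1 u k (z + e κ) := by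
  have h84₁ := eq84_local L hL (1 : Site d → Fin d → 𝔸ˣ) V' u k z hax₁
  have h84₂ := eq84_local L hL (1 : Site d → Fin d → 𝔸ˣ) V' u k (z + e κ) hax₂
  have h92 := eq92 L (1 : Site d → Fin d → 𝔸ˣ) V' k z κ
  have h71 : tildIter L 1 (mgauge 1 u V') k z κ
      = uLev L u k z * tildIter L 1 V' k z κ * (uLev L u k (z + e κ))⁻¹ := by
    rw [tildIter_mgauge, mgauge_apply, B7Eq92Concrete.avgIter_one]
    simp
  rw [B7Eq92Concrete.avgIter_one] at h92
  simp only [Pi.one_apply, B7Eq92Concrete.Rc_one_apply] at h92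
  rw [← h92, h84₁, h84₂, h71]
  group

end Factorisation

/-! ## §2 The collar end: (1.29) below the top gives the factor `1`; the tower axiality from `InAx` -/

section CollarEnd

variable {𝔸 : Type*} [NormedRing 𝔸] [NormedAlgebra ℂ 𝔸] [CompleteSpace 𝔸]

/-- ★ **THE COLLAR FACTOR IS `1`**: if `u` satisfies (1.29) for a family whose level `j` member contains the whole `L`-block under the level-`(j+1)` site `y`
(the family may be EMPTIED at any level `≠ j`, e.g. at the top as in ✓`restr129_product_of_topRows`), then `(R̄₀u)^{(j+1)}(y) = 1`
(✓`restr129_iff_uavg` ∘ ✓`rbar_succ_eq_one_of_block`). [cite: Balaban1985RegularSpaces, (1.29) p.81, p.90 (sentence before (1.78)); Balaban1985Averaging, (78)-(80) p.30] -/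
theorem uavg_succ_eq_one_of_restr129 {L : ℕ} (hL : 1 ≤ L) {m : ℕ} {Λ : ℕ → Set (Site d)} {U₀ : Site d → Fin d → 𝔸ˣ}
    {u : Site d → 𝔸ˣ} (h129 : Restr129 L m Λ U₀ u) {j : ℕ} (hjm : j ≤ m) (y : Site d)
    (hblk : ∀ x ∈ blockSites L y, x ∈ Λ j) :
    uavg L U₀ u (j + 1) y = 1 := by
  have h1 : ∀ x ∈ blockSites L y,
      B7Eq78Linearization.Rbar (B7Eq78Linearization.zdBlocking d L) (B8Eq119TwistedAxial.bgT L U₀) j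
        (fun x => ((u x : 𝔸ˣ) : 𝔸)) x = 1 :=
    fun x hx => h129 j hjm x (hblk x hx)
  have h2 := rbar_succ_eq_one_of_block hL U₀ (fun x => ((u x : 𝔸ˣ) : 𝔸)) j y h1
  rw [rbar_bgT_eq_uavg] at h2
  exact Units.val_eq_one.mp h2

/-- The block under `y` in box letters: `x ∈ blockSites L y → L•y ≤ x ≤ L•y + (L−1)𝟙`. [folklore] -/
theorem box_of_mem_blockSites {L : ℕ} {y x : Site d} (hx : x ∈ blockSites L y) :
    (L : ℤ) • y ≤ x ∧ x ≤ (L : ℤ) • y + blockTop L := by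
  simp only [blockSites, Finset.mem_image, Fintype.mem_piFinset, Finset.mem_range] at hx
  obtain ⟨t, ht, rfl⟩ := hx
  rw [B8Eq119TwistedAxial.blockBase_eq_smul]
  refine ⟨fun i => ?_, fun i => ?_⟩
  · simp only [Pi.add_apply, le_add_iff_nonneg_right]
    exact Int.natCast_nonneg _
  · have := ht i
    simp only [Pi.add_apply, blockTop, add_le_add_iff_left]
    omega

/-- ★ **THE COLLAR FACTOR IS `1`, BOX LETTERS** — `uavg_succ_eq_one_of_restr129` with the block hypothesis in the `L•y ≤ x ≤ L•y + (L−1)𝟙` form of lit's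
class law ✓`B8CubeMemberLamBPrimeLaws.cubeLamBP'_hclass` (alternatives 2∕3). [cite: Balaban1985RegularSpaces, (1.29) p.81, (1.31) p.82] -/
theorem uavg_succ_eq_one_of_restr129_box {L : ℕ} (hL : 1 ≤ L) {m : ℕ} {Λ : ℕ → Set (Site d)} {U₀ : Site d → Fin d → 𝔸ˣ}
    {u : Site d → 𝔸ˣ} (h129 : Restr129 L m Λ U₀ u) {j : ℕ} (hjm : j ≤ m) (y : Site d)
    (hblk : ∀ x, (L : ℤ) • y ≤ x → x ≤ (L : ℤ) • y + blockTop L → x ∈ Λ j) :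
    uavg L U₀ u (j + 1) y = 1 :=
  uavg_succ_eq_one_of_restr129 hL h129 hjm y fun x hx => hblk x (box_of_mem_blockSites hx).1 (box_of_mem_blockSites hx).2

/-- **THE TOWER AXIALITY IN ✓`eq84_local`'s LETTERS FROM `InAx`**: if the datum `U♯ = mgauge 1 u V′` is axial for SOME family `Λ` containing the level-`k` site `y`
(`1 ≤ k`) — J3's pre-gauge gives `InAx … Λ …` for EVERY `Λ` — then the tilde averages of `U♯` are axial in the whole tower under `y` (✓`ax119_iff_ax67`).
[cite: Balaban1985RegularSpaces, (1.19) p.79; Balaban1985Averaging, (67) p.29] -/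
theorem hax_of_inAx {L k : ℕ} (hk : 1 ≤ k) {Λ : ℕ → Set (Site d)} {u : Site d → 𝔸ˣ} {V' : Site d → Fin d → 𝔸ˣ}
    (hAx : InAx L k Λ (1 : Site d → Fin d → 𝔸ˣ) (mgauge 1 u V')) {y : Site d} (hy : y ∈ Λ k) :
    ∀ n, n < k → ∀ w : Site d, Under L (k - (n + 1)) y w → ∀ r : Fin d → Fin L,
      tHol (avgIter L (1 : Site d → Fin d → 𝔸ˣ) n) (tildIter L 1 (mgauge 1 u V') n) ((L : ℤ) • w) (treeWord (boxVec L r)) = 1 := by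
  intro n hn w hw r
  have h := hAx k hk le_rfl y hy n hn w hw r
  rw [show mgauge (1 : Site d → Fin d → 𝔸ˣ) u V' = mgauge 1 u V' * 1 from (mul_one _).symm] at h
  exact (ax119_iff_ax67 L 1 (mgauge 1 u V') n w r).1 h

end CollarEnd

/-! ## §3 The norm estimate: one end factor `1`, the other within `θ`, the middle within `s` -/

section Estimate

variable {𝔸 : Type*} [NormedRing 𝔸] [NormOneClass 𝔸] [NormedAlgebra ℂ 𝔸] [CompleteSpace 𝔸]

omit [NormedAlgebra ℂ 𝔸] [CompleteSpace 𝔸] in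
/-- **ALGEBRA OF THE DEFECT** (either orientation): for units `E₁, T, E₂` with `‖T − 1‖ ≤ s` and either (`E₁ = 1`, `‖E₂ − 1‖ ≤ θ`) or (`‖E₁ − 1‖ ≤ θ`, `E₂ = 1`),
`θ ≤ ½`: `‖E₁⁻¹·T·E₂ − 1‖ ≤ s + 2θ(1 + s)` (in the second case `‖E₁⁻¹ − 1‖ ≤ θ∕(1 − θ) ≤ 2θ` by `r ≤ (1 + r)θ`). [folklore] -/
theorem norm_inv_mul_mul_sub_one_le {E₁ T E₂ : 𝔸ˣ} {s θ : ℝ} (hs0 : 0 ≤ s) (hθ0 : 0 ≤ θ) (hθ : θ ≤ 1 / 2)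
    (hT : ‖(T : 𝔸) - 1‖ ≤ s)
    (hends : (E₁ = 1 ∧ ‖(E₂ : 𝔸) - 1‖ ≤ θ) ∨ (‖(E₁ : 𝔸) - 1‖ ≤ θ ∧ E₂ = 1)) :
    ‖((E₁⁻¹ * T * E₂ : 𝔸ˣ) : 𝔸) - 1‖ ≤ s + 2 * θ * (1 + s) := by
  rcases hends with ⟨rfl, hE⟩ | ⟨hE, rfl⟩
  · -- `E₁ = 1`: `T·E₂ − 1 = (T − 1)(E₂ − 1) + (T − 1) + (E₂ − 1)`
    rw [inv_one, one_mul, Units.val_mul]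
    have hid : (T : 𝔸) * (E₂ : 𝔸) - 1 = ((T : 𝔸) - 1) * ((E₂ : 𝔸) - 1) + ((T : 𝔸) - 1) + ((E₂ : 𝔸) - 1) := by
      noncomm_ring
    rw [hid]
    calc ‖((T : 𝔸) - 1) * ((E₂ : 𝔸) - 1) + ((T : 𝔸) - 1) + ((E₂ : 𝔸) - 1)‖
        ≤ ‖((T : 𝔸) - 1) * ((E₂ : 𝔸) - 1)‖ + ‖(T : 𝔸) - 1‖ + ‖(E₂ : 𝔸) - 1‖ := norm_add₃_le
      _ ≤ s * θ + s + θ := by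
          gcongr
          exact (norm_mul_le _ _).trans (mul_le_mul hT hE (norm_nonneg _) hs0)
      _ ≤ s + 2 * θ * (1 + s) := by nlinarith
  · -- `E₂ = 1`: `E₁⁻¹·T − 1 = (E₁⁻¹ − 1)·T + (T − 1)`, `‖E₁⁻¹ − 1‖ ≤ 2θ`
    rw [mul_one, Units.val_mul]
    set r : ℝ := ‖((E₁⁻¹ : 𝔸ˣ) : 𝔸) - 1‖ with hr
    have hr1 : r ≤ (r + 1) * θ := by
      have hid : ((E₁⁻¹ : 𝔸ˣ) : 𝔸) - 1 = ((E₁⁻¹ : 𝔸ˣ) : 𝔸) * (1 - (E₁ : 𝔸)) := by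
        rw [mul_sub, mul_one, Units.inv_mul]
      have h1 : ‖((E₁⁻¹ : 𝔸ˣ) : 𝔸)‖ ≤ r + 1 := by
        calc ‖((E₁⁻¹ : 𝔸ˣ) : 𝔸)‖ = ‖(((E₁⁻¹ : 𝔸ˣ) : 𝔸) - 1) + 1‖ := by rw [sub_add_cancel]
          _ ≤ ‖((E₁⁻¹ : 𝔸ˣ) : 𝔸) - 1‖ + ‖(1 : 𝔸)‖ := norm_add_le _ _
          _ = r + 1 := by rw [norm_one]
      calc r = ‖((E₁⁻¹ : 𝔸ˣ) : 𝔸) * (1 - (E₁ : 𝔸))‖ := by rw [hr, hid]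
        _ ≤ ‖((E₁⁻¹ : 𝔸ˣ) : 𝔸)‖ * ‖1 - (E₁ : 𝔸)‖ := norm_mul_le _ _
        _ ≤ (r + 1) * θ := by
            apply mul_le_mul h1 _ (norm_nonneg _) (by positivity)
            rwa [norm_sub_rev]
    have hr0 : 0 ≤ r := norm_nonneg _
    have hr2 : r ≤ 2 * θ := by nlinarith
    have hid : ((E₁⁻¹ : 𝔸ˣ) : 𝔸) * (T : 𝔸) - 1 = (((E₁⁻¹ : 𝔸ˣ) : 𝔸) - 1) * (T : 𝔸) + ((T : 𝔸) - 1) := by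
      noncomm_ring
    have hTn : ‖(T : 𝔸)‖ ≤ 1 + s := by
      calc ‖(T : 𝔸)‖ = ‖((T : 𝔸) - 1) + 1‖ := by rw [sub_add_cancel]
        _ ≤ ‖(T : 𝔸) - 1‖ + ‖(1 : 𝔸)‖ := norm_add_le _ _
        _ ≤ 1 + s := by rw [norm_one]; linarith
    rw [hid]
    calc ‖(((E₁⁻¹ : 𝔸ˣ) : 𝔸) - 1) * (T : 𝔸) + ((T : 𝔸) - 1)‖
        ≤ ‖(((E₁⁻¹ : 𝔸ˣ) : 𝔸) - 1) * (T : 𝔸)‖ + ‖(T : 𝔸) - 1‖ := norm_add_le _ _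
      _ ≤ r * (1 + s) + s := by
          gcongr
          exact (norm_mul_le _ _).trans (mul_le_mul_of_nonneg_left hTn hr0)
      _ ≤ s + 2 * θ * (1 + s) := by nlinarith

/-- ★★ **THE DEFECT BOUND ON THE TOP DOUBLE-BAR VARIABLE** (GLOBAL form, no exponent): under the tower axiality of `U♯ = mgauge 1 u V′` below both end-blocks,
`‖Ũ♯^{(k)}(c) − 1‖ ≤ s` ((1.35)@k, J3 (d) at depth `0`), one end factor `(R̄₀u)^{(k)} = 1` ((1.29) at `k − 1` on the collar, §2) and the other within `θ` of `1`,
and `s + 2θ(1+s) ≤ ½`: `‖mlog U̿^{(k)}(V′)(c)‖ ≤ 2(s + 2θ(1+s))` (§1 ∘ §3 algebra ∘ ✓`MatrixLog.norm_mlog_le_two_mul`).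
[cite: Balaban1985RegularSpaces, (1.37) p.82, (1.42) p.83, (1.35) p.82; Balaban1985Averaging, (92) p.31, (84) p.30, (21)-(23) p.21] -/
theorem norm_mlog_dbavgCovIter_one_le_of_defect (L : ℕ) (hL : 1 ≤ L) (u : Site d → 𝔸ˣ) (V' : Site d → Fin d → 𝔸ˣ) (k : ℕ)
    (z : Site d) (κ : Fin d)
    (hax₁ : ∀ n, n < k → ∀ w : Site d, Under L (k - (n + 1)) z w → ∀ r : Fin d → Fin L,
      tHol (avgIter L (1 : Site d → Fin d → 𝔸ˣ) n) (tildIter L 1 (mgauge 1 u V') n) ((L : ℤ) • w) (treeWord (boxVec L r)) = 1)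
    (hax₂ : ∀ n, n < k → ∀ w : Site d, Under L (k - (n + 1)) (z + e κ) w → ∀ r : Fin d → Fin L,
      tHol (avgIter L (1 : Site d → Fin d → 𝔸ˣ) n) (tildIter L 1 (mgauge 1 u V') n) ((L : ℤ) • w) (treeWord (boxVec L r)) = 1)
    {s θ : ℝ} (hs0 : 0 ≤ s) (hθ0 : 0 ≤ θ) (hθ : θ ≤ 1 / 2)
    (hs : ‖(tildIter L 1 (mgauge 1 u V') k z κ : 𝔸) - 1‖ ≤ s)
    (hends : (uavg L 1 u k z = 1 ∧ ‖(uavg L 1 u k (z + e κ) : 𝔸) - 1‖ ≤ θ) ∨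
      (‖(uavg L 1 u k z : 𝔸) - 1‖ ≤ θ ∧ uavg L 1 u k (z + e κ) = 1))
    (hhalf : s + 2 * θ * (1 + s) ≤ 1 / 2) :
    ‖mlog ((dbavgCovIter L 1 V' k z κ : 𝔸ˣ) : 𝔸)‖ ≤ 2 * (s + 2 * θ * (1 + s)) := by
  rw [dbavgCovIter_one_eq_uavg_conj L hL u V' k z κ hax₁ hax₂]
  have h1 := norm_inv_mul_mul_sub_one_le hs0 hθ0 hθ hs hends
  exact (norm_mlog_le_two_mul (h1.trans hhalf)).trans (by linarith)

end Estimate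

/-! ## §4 The tower-local (1.42) clause at a crossing top bond with a defect -/

section Local

variable {𝔸 : Type*} [CStarAlgebra 𝔸] [Nontrivial 𝔸]

omit [Nontrivial 𝔸] in
/-- `pdev 1 = 0` (plumbing: every plaquette holonomy of the flat field is `1`). [folklore] -/
theorem pdev_one : B7Prop2Explicit.pdev (1 : Site d → Fin d → 𝔸ˣ) = 0 := by
  unfold B7Prop2Explicit.pdev
  simp [B8Ineq130.hol_one]

/-- Restriction of an agreement to a sub-box (plumbing, as in lit's `B8Eq142KLevelLocal`). [folklore] -/
theorem agreeOn_of_subbox {G : Type*} {lo hi LO HI : Site d} {V V' : Site d → Fin d → G}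
    (hsub : ∀ x, InBox lo hi x → InBox LO HI x) (h : AgreeOn LO HI V V') : AgreeOn lo hi V V' :=
  fun x κ hx hxe => h x κ (hsub x hx) (hsub _ hxe)

omit [Nontrivial 𝔸] in
/-- **LOCALITY OF THE DOUBLE-BAR VARIABLE AT THE FLAT BACKGROUND**: `U̿^{(k)}(V)(c)` depends only on `V` on the box `Bᵏ(c₋) ∪ Bᵏ(c₊)` ([3] (92): the frames are
tower-local — ✓`wrec_congr_tower` —, the averages box-local — ✓`avgIter_congr`). [cite: Balaban1985Averaging, (92) p.31, (85) p.31, p.24 (locality of (43))] -/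
theorem dbavgCovIter_one_congr (L : ℕ) (hL : 1 ≤ L) (k : ℕ) (y : Site d) (κ : Fin d) {V V' : Site d → Fin d → 𝔸ˣ}
    (h : AgreeOn (loK L k y) (bondHiK L k y κ) V V') :
    dbavgCovIter L 1 V k y κ = dbavgCovIter L 1 V' k y κ := by
  have h1 : (1 : Site d → Fin d → 𝔸ˣ) = 1 := rfl
  have hag1 : ∀ lo hi : Site d, AgreeOn lo hi (1 : Site d → Fin d → 𝔸ˣ) 1 := fun _ _ _ _ _ _ => rfl
  have hw₁ : wrec L 1 V k y = wrec L 1 V' k y :=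
    wrec_congr_tower hL (hag1 _ _) (agreeOn_of_subbox (fun x hx => inBox_box_of_tower_fst L k y κ hx) h) k 0 (by omega) y
      (by rw [B8Ineq130.tlo_zero]) (by rw [B8Ineq130.thi_zero])
  have hw₂ : wrec L 1 V k (y + e κ) = wrec L 1 V' k (y + e κ) :=
    wrec_congr_tower hL (hag1 _ _) (agreeOn_of_subbox (fun x hx => inBox_box_of_tower_snd k y κ hx) h) k 0 (by omega) (y + e κ)
      (by rw [B8Ineq130.tlo_zero]) (by rw [B8Ineq130.thi_zero])
  have ht : tildIter L 1 V k y κ = tildIter L 1 V' k y κ := by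
    rw [tildIter_apply, tildIter_apply, avgIter_congr L hL k y κ (B7LocalityGeneral.agreeOn_mul h (hag1 _ _))]
  rw [← eq92 L 1 V k y κ, ← eq92 L 1 V' k y κ, hw₁, hw₂, ht]

/-- ★★★ **THE (1.42) CLAUSE AT A CROSSING TOP BOND WITH A DEFECT, FROM BOX DATA** (flat background; the mixed-end twin of lit ✓`norm_Qj_lt_crossing_loc`):
at a level-`(j+1)` bond `c = ⟨y, y + e_κ⟩`, if on the box `B^{j+1}(c₋) ∪ B^{j+1}(c₊)` the field is `V′ = e^{B}` with `‖B‖ ≤ b`, `L^{j+1}b` in [3] Prop. 4's window,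
the datum `U♯ = mgauge 1 u V′` is axial in the towers under both end-blocks, `‖Ũ♯^{(j+1)}(c) − 1‖ ≤ s`, one end factor `(R̄₀u)^{(j+1)} = 1` and the other within `θ`
of `1` (either orientation), THEN `‖Q_{j+1}(1, B)(c)‖ < 2dLα₁` under the displayed scalar row `2(s + 2θ(1+s)) < 2dLα₁` (+ `s + 2θ(1+s) ≤ ½`).  Proof: clamp the exponent
to the box (so that the (127) identification ✓`dbavgCovIter_eq_expCfg_logCovIter` applies globally at `pdev 1 = 0`), ✓`logCovIter_congr`, ✓`logCovIter_succ_eq_mlog`,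
`dbavgCovIter_one_congr` back to `V′`, then §3.
[cite: Balaban1985RegularSpaces, (1.42) p.83, (1.37) + (1.31) p.82, (1.35) p.82, (1.29) p.81; Balaban1985Averaging, (127) p.37, Prop. 4 pp.38-39, (92) p.31, (84) p.30] -/
theorem norm_logCovIter_succ_lt_crossing_of_defect_loc (L : ℕ) (hL : 2 ≤ L) (j : ℕ) (y : Site d) (κ : Fin d)
    {α₀ : ℝ} (hα₀ : 0 < α₀) (hα3 : C0 d * α₀ ≤ 1 / 3) (hα4 : 4 * α₀ ≤ c2' d L)
    (B : Site d → Fin d → 𝔸) {b : ℝ} (hb : 0 ≤ b)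
    (hB : ∀ x μ, BondIn (loK L (j + 1) y) (bondHiK L (j + 1) y κ) x μ → ‖B x μ‖ ≤ b)
    (hsm : Real.exp (4 * (800 * ((d : ℝ) + 1) ^ 2 * ((d : ℝ) + 4)) * α₀)
      * (1 + 8 * (131072 * ((d : ℝ) + 1) ^ 2) * ((L : ℝ) ^ (j + 1) * b)) ≤ 2)
    (hc₃ : 2 * ((L : ℝ) ^ (j + 1) * b) ≤ c3 d L)
    (u : Site d → 𝔸ˣ) (V' : Site d → Fin d → 𝔸ˣ)
    (hV : AgreeOn (loK L (j + 1) y) (bondHiK L (j + 1) y κ) V' (expCfg B))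
    (hax₁ : ∀ n, n < j + 1 → ∀ w : Site d, Under L (j + 1 - (n + 1)) y w → ∀ r : Fin d → Fin L,
      tHol (avgIter L (1 : Site d → Fin d → 𝔸ˣ) n) (tildIter L 1 (mgauge 1 u V') n) ((L : ℤ) • w) (treeWord (boxVec L r)) = 1)
    (hax₂ : ∀ n, n < j + 1 → ∀ w : Site d, Under L (j + 1 - (n + 1)) (y + e κ) w → ∀ r : Fin d → Fin L,
      tHol (avgIter L (1 : Site d → Fin d → 𝔸ˣ) n) (tildIter L 1 (mgauge 1 u V') n) ((L : ℤ) • w) (treeWord (boxVec L r)) = 1)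
    {s θ : ℝ} (hs0 : 0 ≤ s) (hθ0 : 0 ≤ θ) (hθ : θ ≤ 1 / 2)
    (hs : ‖(tildIter L 1 (mgauge 1 u V') (j + 1) y κ : 𝔸) - 1‖ ≤ s)
    (hends : (uavg L 1 u (j + 1) y = 1 ∧ ‖(uavg L 1 u (j + 1) (y + e κ) : 𝔸) - 1‖ ≤ θ) ∨
      (‖(uavg L 1 u (j + 1) y : 𝔸) - 1‖ ≤ θ ∧ uavg L 1 u (j + 1) (y + e κ) = 1))
    (hhalf : s + 2 * θ * (1 + s) ≤ 1 / 2) {α₁ : ℝ} (hwin : 2 * (s + 2 * θ * (1 + s)) < 2 * d * L * α₁) :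
    ‖logCovIter L 1 B (j + 1) y κ‖ < 2 * d * L * α₁ := by
  have hL1 : 1 ≤ L := le_trans (by norm_num) hL
  set lo := loK L (j + 1) y with hlo
  set hi := bondHiK L (j + 1) y κ with hhi
  have hlohi : ∀ i, lo i ≤ hi i := fun i => by
    have hP : (1 : ℤ) ≤ (L : ℤ) ^ (j + 1) := one_le_pow₀ (by exact_mod_cast hL1)
    simp only [hlo, hhi, loK, bondHiK]
    split_ifs <;> nlinarith
  -- the clamped exponent
  set Bc : Site d → Fin d → 𝔸 := fun x μ => if lo μ ≤ x μ ∧ x μ < hi μ then B (clamp lo hi x) μ else 0 with hBc_def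
  have hBc : ∀ x μ, ‖Bc x μ‖ ≤ b := by
    intro x μ
    by_cases hP : lo μ ≤ x μ ∧ x μ < hi μ
    · simp only [hBc_def, hP, and_self, if_true]
      have hx := clamp_inBox hlohi x
      have hxe : InBox lo hi (clamp lo hi x + e μ) := by
        rw [← B7Prop1Local.clamp_add_e_of hP]; exact clamp_inBox hlohi _
      exact hB _ μ ⟨hx, hxe⟩
    · simp only [hBc_def, hP, if_false, norm_zero]
      exact hb
  have hagB : AgreeOn lo hi B Bc := fun x μ hx hxe => by
    have hr : lo μ ≤ x μ ∧ x μ < hi μ :=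
      ⟨(hx μ).1, by have := (hxe μ).2; rw [B7Prop1Local.add_e_apply, if_pos rfl] at this; omega⟩
    simp only [hBc_def, hr, and_self, if_true, clamp_of_inBox hx]
  have hagE : AgreeOn lo hi (expCfg Bc) V' := fun x μ hx hxe => by
    rw [hV x μ hx hxe]
    show B7Prop1Explicit.expUnit (Bc x μ) = B7Prop1Explicit.expUnit (B x μ)
    rw [hagB x μ hx hxe]
  -- the (127) identification for the clamped exponent at the flat background, all levels `≤ j + 1`
  have hG : AvgClosed d L (unitaryUnits 𝔸) := avgClosed_unitaryUnits d L
  have h52 : B7Prop2Explicit.pdev (1 : Site d → Fin d → 𝔸ˣ) < α₀ * (((L : ℝ) ^ (j + 1))⁻¹) ^ 2 := by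
    rw [pdev_one]; positivity
  have hId := dbavgCovIter_eq_expCfg_logCovIter L hL hG (j + 1) (1 : Site d → Fin d → 𝔸ˣ)
    (fun _ _ => (unitaryUnits 𝔸).one_mem) hα₀ hα3 hα4 h52 Bc hb hBc hsm hc₃ j (Nat.le_succ j)
  -- `Q_{j+1}(1, B)(c) = Q_{j+1}(1, Bc)(c) = log U̿(e^{Bc})(c) = log U̿(V′)(c)`
  have hagU : AgreeOn lo hi (1 : Site d → Fin d → 𝔸ˣ) 1 := fun _ _ _ _ => rfl
  rw [logCovIter_congr L hL1 (j + 1) y κ hagU hagB, logCovIter_succ_eq_mlog L 1 Bc j hId y κ,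
    dbavgCovIter_one_congr L hL1 (j + 1) y κ hagE]
  exact (norm_mlog_dbavgCovIter_one_le_of_defect L hL1 u V' (j + 1) y κ hax₁ hax₂ hs0 hθ0 hθ hs hends hhalf).trans_lt hwin

end Local

end Summit.QuantumFields.YangMills.Theorems.HalvingTopCrossingQkOfDefect

end
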